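import Summits.KontsevichZagierPeriods.Zeta5Search.Barrier.ConeGammaCuspPeriodFiniteForms

/-!
# ζ(5) search — BARRIER: THE CHAMBER ASCENT VALUE — the steepest normalised ascent of a chamber equals the least defect of a wall-gap representation

HONEST FRAMING (cell `pub-zeta5`): systematic search; no irrationality claim unless kernel-certified. MODEL objects
under Brown–Zudilin's (28)+(30) accounting ([BZ22] = arXiv:2210.03391; (28) observed, not proved); nothing here is a
statement about `ζ(5)`, any `γ` of record, the cone's supremum (C2 OPEN) or the value / sign of the cusp slope at a
named direction (DATA of the cell); no value, multiplier or ray at a named direction enters the kernel; S-E stays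
CONJECTURED; records in print UNMOVED. Prover P2 g35, item «THE RAY CRITERION AND THE ORDER-TYPE FORM», file (4)
(theorems only) — P2 g34's successor menu (e) «LP duality form», with its use: the exact size of a FAILED certificate.

THE POINT. For a generic reference `δ₀` the cusp slope `σ` is the linear chamber functional `G_{δ₀}` on the closed
chamber `C(δ₀)`; P2 g34's Farkas certificate says `G_{δ₀}` is a NON-POSITIVE combination of the chamber's wall gaps
`r_l − r_k` (`ρ₀ k < ρ₀ l`), and exists iff the chamber holds no ascent direction. When it fails, by how much? The
tree's LP DUALITY (`Literature.Analysis.Convex.LPDuality.exists_optimal_pair_of_forall_le`, Schrijver Cor. 7.1g) on the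
chamber cut to wall gaps in `[0, 1]` answers exactly:
* **`chamber_value_duality`** — THE CHAMBER ASCENT VALUE: the maximum `v(δ₀)` of `σ` over `{δ ∈ C(δ₀) : every selected
  wall gap ≤ 1}` is ATTAINED and EQUALS the minimum, over all representations `G_{δ₀} ≡ Σ_{ρ₀k<ρ₀l} (ν_{kl} − μ_{kl})·
  (r_l − r_k)` with `μ, ν ≥ 0`, of the total positive part `Σ ν_{kl}` — the least DEFECT of a wall-gap representation;
  `v(δ₀) = 0` iff a Farkas certificate exists (take `ν = 0`; P2 g34), and when `v(δ₀) > 0` the maximum sits at a ray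
  (file (2), `exists_ascent_ray_of_cuspSlope_pos`);
* **`cuspSlope_le_spread_mul_value`** — the value certifies the chamber from above: `σ(δ) ≤ s·v(δ₀)` for every `δ ∈
  C(δ₀)` whose selected wall gaps are `≤ s` (`s ≥ 0`), an exact affine bound with the defect as the constant;
* canonical form (P2 g33's `F = Σ_b patternN_b`; hpos / hT / hper / hF only).
NOT here: any value at a named direction (the desk's `v/P` at record/41, flag/60, argmax-120, t*/480 are DATA in
`HOME/pub-zeta5-p2/g35/alg/`); `γ`, C2, S-E, `ζ(5)`.
-/

noncomputable section

open Set MeasureTheory Finset Matrix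
open scoped Topology

namespace Summit.KontsevichZagierPeriods.Zeta5Search.Barrier.ConeGamma

/-! ### The chamber ascent value and its dual -/

/-- **THE CHAMBER ASCENT VALUE = THE LEAST DEFECT OF A WALL-GAP REPRESENTATION** (any period pattern function `F`, any
extension; the tree's LP duality, Schrijver Cor. 7.1g). All 28 forms of `a` positive, `T > 0` a period, `δ₀` generic.
There are a displacement `x` in the closed chamber of `δ₀` with every selected wall gap `r_l(x) − r_k(x) ≤ 1`
(`ρ₀ k < ρ₀ l`) and multipliers `μ, ν ≥ 0` on the selected pairs with
`G_{δ₀}(δ) = Σ_{ρ₀k<ρ₀l} (ν_{kl} − μ_{kl})·(r_l(δ) − r_k(δ))` for every `δ` and `cuspSlope a T x = Σ_{ρ₀k<ρ₀l} ν_{kl}`,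
such that (i) `cuspSlope a T δ ≤ cuspSlope a T x` for every `δ` in the closed chamber with selected gaps `≤ 1` (so
`σ(x)` is the chamber's ascent value), and (ii) `cuspSlope a T x ≤ Σ ν'` for every other such representation `(μ', ν')`
(so the value is the least defect). No value at a named direction is asserted. -/
theorem chamber_value_duality {a : Dir} (hpos : ∀ k, 0 < h28 a k) {T : ℝ} (hT : 0 < T)
    (hper : ∀ k : Fin 28, ∃ z : ℤ, T * h28 a k = z)
    {M : ℕ → Finset (Fin 28)} {f : ℕ → Finset (Fin 28) → ℝ}
    (hf : ∀ m, m + 1 < (bkpts a T).card → ∀ Δ : Fin 8 → ℝ, (∀ k, |phiForm Δ k| < 1) →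
      (∀ k, |phiForm Δ k| < wallDist a T) →
        (torusN (bkpt a T m • sParam a + Δ) : ℝ) = f m ((M m).filter fun k => 0 ≤ phiForm Δ k))
    {F : Finset (Fin 28) → ℝ} (hF : ∀ A, F A = ∑ m ∈ Finset.range ((bkpts a T).card - 1), f m (A ∩ M m))
    {δ₀ : Fin 8 → ℝ} (hgen : ∀ k l : Fin 28, k ≠ l → phiForm δ₀ k / h28 a k ≠ phiForm δ₀ l / h28 a l) :
    ∃ (x : Fin 8 → ℝ) (μ ν : Fin 28 → Fin 28 → ℝ),
      (∀ k l : Fin 28, phiForm x k / h28 a k < phiForm x l / h28 a l →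
        phiForm δ₀ k / h28 a k < phiForm δ₀ l / h28 a l) ∧
      (∀ k l : Fin 28, phiForm δ₀ k / h28 a k < phiForm δ₀ l / h28 a l →
        phiForm x l / h28 a l - phiForm x k / h28 a k ≤ 1) ∧
      (∀ k l, 0 ≤ μ k l) ∧ (∀ k l, 0 ≤ ν k l) ∧
      (∀ δ : Fin 8 → ℝ,
        ∑ k, (F (Finset.univ.filter fun l => phiForm δ₀ k / h28 a k ≤ phiForm δ₀ l / h28 a l) -
            F (Finset.univ.filter fun l => phiForm δ₀ k / h28 a k < phiForm δ₀ l / h28 a l)) *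
          (phiForm δ k / h28 a k) =
        ∑ k, ∑ l, (if phiForm δ₀ k / h28 a k < phiForm δ₀ l / h28 a l then
          (ν k l - μ k l) * (phiForm δ l / h28 a l - phiForm δ k / h28 a k) else 0)) ∧
      cuspSlope a T x = ∑ k, ∑ l, (if phiForm δ₀ k / h28 a k < phiForm δ₀ l / h28 a l then ν k l else 0) ∧
      (∀ δ : Fin 8 → ℝ, (∀ k l : Fin 28, phiForm δ k / h28 a k < phiForm δ l / h28 a l →
          phiForm δ₀ k / h28 a k < phiForm δ₀ l / h28 a l) →
        (∀ k l : Fin 28, phiForm δ₀ k / h28 a k < phiForm δ₀ l / h28 a l →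
          phiForm δ l / h28 a l - phiForm δ k / h28 a k ≤ 1) → cuspSlope a T δ ≤ cuspSlope a T x) ∧
      (∀ μ' ν' : Fin 28 → Fin 28 → ℝ, (∀ k l, 0 ≤ μ' k l) → (∀ k l, 0 ≤ ν' k l) →
        (∀ δ : Fin 8 → ℝ,
          ∑ k, (F (Finset.univ.filter fun l => phiForm δ₀ k / h28 a k ≤ phiForm δ₀ l / h28 a l) -
              F (Finset.univ.filter fun l => phiForm δ₀ k / h28 a k < phiForm δ₀ l / h28 a l)) *
            (phiForm δ k / h28 a k) =
          ∑ k, ∑ l, (if phiForm δ₀ k / h28 a k < phiForm δ₀ l / h28 a l then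
            (ν' k l - μ' k l) * (phiForm δ l / h28 a l - phiForm δ k / h28 a k) else 0)) →
        cuspSlope a T x ≤ ∑ k, ∑ l, (if phiForm δ₀ k / h28 a k < phiForm δ₀ l / h28 a l then ν' k l else 0)) := by
  classical
  -- shorthand: the chamber weights, rates as dot products, the objective vector
  obtain ⟨W, hW⟩ : ∃ W : Fin 28 → ℝ, ∀ k, W k =
      F (Finset.univ.filter fun l => phiForm δ₀ k / h28 a k ≤ phiForm δ₀ l / h28 a l) -
        F (Finset.univ.filter fun l => phiForm δ₀ k / h28 a k < phiForm δ₀ l / h28 a l) := ⟨_, fun _ => rfl⟩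
  obtain ⟨n, hn⟩ : ∃ n : Fin 28 → Fin 8 → ℝ, ∀ k p, n k p = phiForm (Pi.single p (1 : ℝ)) k / h28 a k :=
    ⟨_, fun _ _ => rfl⟩
  have hrate : ∀ (y : Fin 8 → ℝ) k, n k ⬝ᵥ y = phiForm y k / h28 a k := fun y k => by
    rw [rate_eq_sum_coord a y k, dotProduct]
    exact Finset.sum_congr rfl fun p _ => by rw [hn, mul_comm]
  obtain ⟨c, hc⟩ : ∃ c : Fin 8 → ℝ, ∀ p, c p = ∑ k, W k * (phiForm (Pi.single p (1 : ℝ)) k / h28 a k) :=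
    ⟨_, fun _ => rfl⟩
  have hobj : ∀ y : Fin 8 → ℝ, c ⬝ᵥ y = ∑ k, W k * (phiForm y k / h28 a k) := fun y => by
    rw [sum_mul_rate_eq_sum_coord a W y, dotProduct]
    exact Finset.sum_congr rfl fun p _ => by rw [hc, mul_comm]
  have hσ : ∀ y : Fin 8 → ℝ, (∀ k l : Fin 28, phiForm y k / h28 a k < phiForm y l / h28 a l →
      phiForm δ₀ k / h28 a k < phiForm δ₀ l / h28 a l) → cuspSlope a T y = c ⬝ᵥ y := fun y hy => by
    rw [hobj, cuspSlope_eq_greedy_period_of_refines hpos hT hper hf hF hgen y hy]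
    simp only [hW]
  -- the LP: rows `gap ≥ 0` (inl) and `gap ≤ 1` (inr) on the selected pairs
  obtain ⟨A, hA⟩ : ∃ A : Matrix ((Fin 28 × Fin 28) ⊕ (Fin 28 × Fin 28)) (Fin 8) ℝ, A =
      Sum.elim (fun kl : Fin 28 × Fin 28 =>
          if phiForm δ₀ kl.1 / h28 a kl.1 < phiForm δ₀ kl.2 / h28 a kl.2 then n kl.1 - n kl.2 else 0)
        (fun kl : Fin 28 × Fin 28 =>
          if phiForm δ₀ kl.1 / h28 a kl.1 < phiForm δ₀ kl.2 / h28 a kl.2 then n kl.2 - n kl.1 else 0) := ⟨_, rfl⟩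
  obtain ⟨b, hb⟩ : ∃ b : (Fin 28 × Fin 28) ⊕ (Fin 28 × Fin 28) → ℝ, b =
      Sum.elim (fun _ => 0) (fun kl : Fin 28 × Fin 28 =>
        if phiForm δ₀ kl.1 / h28 a kl.1 < phiForm δ₀ kl.2 / h28 a kl.2 then 1 else 0) := ⟨_, rfl⟩
  have feas_iff : ∀ y : Fin 8 → ℝ, A *ᵥ y ≤ b ↔
      (∀ k l : Fin 28, phiForm δ₀ k / h28 a k < phiForm δ₀ l / h28 a l →
        phiForm y k / h28 a k ≤ phiForm y l / h28 a l) ∧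
      (∀ k l : Fin 28, phiForm δ₀ k / h28 a k < phiForm δ₀ l / h28 a l →
        phiForm y l / h28 a l - phiForm y k / h28 a k ≤ 1) := by
    intro y
    constructor
    · intro hy
      refine ⟨fun k l hkl => ?_, fun k l hkl => ?_⟩
      · have h := hy (Sum.inl (k, l))
        simp only [hA, hb, mulVec, Sum.elim_inl, if_pos hkl] at h
        rw [sub_dotProduct, hrate, hrate] at h
        linarith
      · have h := hy (Sum.inr (k, l))
        simp only [hA, hb, mulVec, Sum.elim_inr, if_pos hkl] at h
        rwa [sub_dotProduct, hrate, hrate] at h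
    · rintro ⟨h0, h1⟩ i
      rcases i with ⟨k, l⟩ | ⟨k, l⟩
      · simp only [hA, hb, mulVec, Sum.elim_inl]
        split_ifs with hkl
        · rw [sub_dotProduct, hrate, hrate, sub_nonpos]; exact h0 k l hkl
        · rw [zero_dotProduct]
      · simp only [hA, hb, mulVec, Sum.elim_inr]
        split_ifs with hkl
        · rw [sub_dotProduct, hrate, hrate]; exact h1 k l hkl
        · rw [zero_dotProduct]
  -- slowest / fastest form; bounded objective
  obtain ⟨m, -, hm⟩ := Finset.exists_min_image Finset.univ (fun k => phiForm δ₀ k / h28 a k) Finset.univ_nonempty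
  obtain ⟨Mx, -, hM⟩ := Finset.exists_max_image Finset.univ (fun k => phiForm δ₀ k / h28 a k) Finset.univ_nonempty
  have hm' : ∀ k, k ≠ m → phiForm δ₀ m / h28 a m < phiForm δ₀ k / h28 a k := fun k hk =>
    lt_of_le_of_ne (hm k (Finset.mem_univ _)) (hgen m k (Ne.symm hk))
  have hM' : ∀ k, k ≠ Mx → phiForm δ₀ k / h28 a k < phiForm δ₀ Mx / h28 a Mx := fun k hk =>
    lt_of_le_of_ne (hM k (Finset.mem_univ _)) (hgen k Mx hk)
  have hbound : ∀ y : Fin 8 → ℝ, A *ᵥ y ≤ b → c ⬝ᵥ y ≤ ∑ k, |W k| := by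
    intro y hy
    obtain ⟨h0, h1⟩ := (feas_iff y).mp hy
    -- shift to `r_m = 0`: rates then lie in `[0, 1]`, and the value is unchanged (`ΣW = 0`)
    have hWs := period_greedy_sum_eq_zero hpos hT hper hf hF hgen
    simp only [← hW] at hWs
    have h01 : ∀ k, 0 ≤ phiForm y k / h28 a k - phiForm y m / h28 a m ∧
        phiForm y k / h28 a k - phiForm y m / h28 a m ≤ 1 := by
      intro k
      have hlo : phiForm y m / h28 a m ≤ phiForm y k / h28 a k := by
        by_cases hk : k = m; · rw [hk]
        exact h0 m k (hm' k hk)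
      have hhi : phiForm y k / h28 a k ≤ phiForm y Mx / h28 a Mx := by
        by_cases hk : k = Mx; · rw [hk]
        exact h0 k Mx (hM' k hk)
      have hsp : phiForm y Mx / h28 a Mx - phiForm y m / h28 a m ≤ 1 := by
        by_cases hmM : m = Mx
        · rw [hmM, sub_self]; exact zero_le_one
        · exact h1 m Mx (hm' Mx (Ne.symm hmM))
      exact ⟨by linarith, by linarith⟩
    rw [hobj]
    calc ∑ k, W k * (phiForm y k / h28 a k)
        = ∑ k, W k * (phiForm y k / h28 a k - phiForm y m / h28 a m) := by
          simp_rw [mul_sub]; rw [Finset.sum_sub_distrib, ← Finset.sum_mul, hWs, zero_mul, sub_zero]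
      _ ≤ ∑ k, |W k| := Finset.sum_le_sum fun k _ =>
          (mul_le_mul_of_nonneg_right (le_abs_self _) (h01 k).1).trans (mul_le_of_le_one_right (abs_nonneg _) (h01 k).2)
  -- strong duality
  have hz : ∀ k, phiForm (0 : Fin 8 → ℝ) k / h28 a k = 0 := fun k => by
    rw [show (0 : Fin 8 → ℝ) = (0 : ℝ) • sParam a by rw [zero_smul], phiForm_smul_sParam, zero_mul, zero_div]
  obtain ⟨x, y, hxfeas, hy0, hyA, hgap⟩ :=
    Literature.Analysis.Convex.LPDuality.exists_optimal_pair_of_forall_le (𝕜 := ℝ) A b c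
      ⟨0, (feas_iff 0).mpr ⟨fun k l _ => by rw [hz, hz], fun k l _ => by rw [hz, hz, sub_zero]; exact zero_le_one⟩⟩
      hbound
  obtain ⟨hx0, hx1⟩ := (feas_iff x).mp hxfeas
  have hxref := refines_of_forall_rate_le hgen hx0
  -- the multipliers and the representation
  refine ⟨x, fun k l => y (Sum.inl (k, l)), fun k l => y (Sum.inr (k, l)), hxref, hx1,
    fun k l => hy0 _, fun k l => hy0 _, fun δ => ?_, ?_, fun δ hδ hδ1 => ?_, fun μ' ν' hμ' hν' hrep => ?_⟩
  · -- `G_{δ₀}(δ) = c·δ = (y A)·δ = Σ_sel (ν − μ)(r_l − r_k)(δ)`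
    have h1 : ∑ k, W k * (phiForm δ k / h28 a k) = (y ᵥ* A) ⬝ᵥ δ := by rw [hyA, hobj]
    simp only [← hW]
    rw [h1, ← dotProduct_mulVec, dotProduct, Fintype.sum_sum_type]
    simp only [hA, mulVec, Sum.elim_inl, Sum.elim_inr]
    rw [Fintype.sum_prod_type, Fintype.sum_prod_type, ← Finset.sum_add_distrib]
    refine Finset.sum_congr rfl fun k _ => ?_
    rw [← Finset.sum_add_distrib]
    refine Finset.sum_congr rfl fun l _ => ?_
    split_ifs with hkl
    · rw [sub_dotProduct, sub_dotProduct, hrate, hrate]; ring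
    · rw [zero_dotProduct]; ring
  · -- the value: `σ(x) = c·x = y·b = Σ_sel ν`
    rw [hσ x hxref, hgap, dotProduct, Fintype.sum_sum_type]
    simp only [hb, Sum.elim_inl, Sum.elim_inr, mul_zero, Finset.sum_const_zero, zero_add]
    rw [Fintype.sum_prod_type]
    exact Finset.sum_congr rfl fun k _ => Finset.sum_congr rfl fun l _ => by
      split_ifs <;> simp
  · -- primal optimality
    rw [hσ δ hδ, hσ x hxref, hgap]
    have hδfeas : A *ᵥ δ ≤ b := (feas_iff δ).mpr ⟨fun k l hkl => rate_le_rate_of_refines hδ hkl, hδ1⟩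
    exact Literature.Analysis.Convex.LPDuality.weak_duality hδfeas hy0 hyA
  · -- dual optimality: any representation gives a dual feasible point with objective `Σ ν'`
    obtain ⟨y', hy'⟩ : ∃ y' : (Fin 28 × Fin 28) ⊕ (Fin 28 × Fin 28) → ℝ,
        y' = Sum.elim (fun kl => μ' kl.1 kl.2) (fun kl => ν' kl.1 kl.2) := ⟨_, rfl⟩
    have hy'0 : 0 ≤ y' := fun i => by
      rcases i with ⟨k, l⟩ | ⟨k, l⟩
      · rw [Pi.zero_apply, hy', Sum.elim_inl]; exact hμ' k l
      · rw [Pi.zero_apply, hy', Sum.elim_inr]; exact hν' k l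
    have hy'A : y' ᵥ* A = c := by
      -- both sides are linear functionals agreeing on every `δ`
      have hfun : ∀ δ : Fin 8 → ℝ, (y' ᵥ* A) ⬝ᵥ δ = c ⬝ᵥ δ := fun δ => by
        rw [hobj, ← dotProduct_mulVec, dotProduct, Fintype.sum_sum_type]
        simp only [← hW] at hrep
        rw [hrep δ]
        simp only [hA, hy', mulVec, Sum.elim_inl, Sum.elim_inr]
        rw [Fintype.sum_prod_type, Fintype.sum_prod_type, ← Finset.sum_add_distrib]
        refine Finset.sum_congr rfl fun k _ => ?_
        rw [← Finset.sum_add_distrib]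
        refine Finset.sum_congr rfl fun l _ => ?_
        split_ifs with hkl
        · rw [sub_dotProduct, sub_dotProduct, hrate, hrate]; ring
        · rw [zero_dotProduct]; ring
      funext p
      have h := hfun (Pi.single p 1)
      rwa [dotProduct_single_one, dotProduct_single_one] at h
    have hwd := Literature.Analysis.Convex.LPDuality.weak_duality hxfeas hy'0 hy'A
    rw [hσ x hxref]
    refine hwd.trans (le_of_eq ?_)
    rw [dotProduct, Fintype.sum_sum_type]
    simp only [hb, hy', Sum.elim_inl, Sum.elim_inr, mul_zero, Finset.sum_const_zero, zero_add]
    rw [Fintype.sum_prod_type]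
    exact Finset.sum_congr rfl fun k _ => Finset.sum_congr rfl fun l _ => by
      split_ifs <;> simp

/-- **THE VALUE CERTIFIES THE CHAMBER FROM ABOVE** (any `F`; all 28 forms of `a` positive, `T > 0` a period, `δ₀`
generic): if `x` maximises the cusp slope over the closed chamber of `δ₀` cut to selected wall gaps `≤ 1` (as in
`chamber_value_duality`), then for every `s ≥ 0` and every `δ` in the closed chamber with selected wall gaps `≤ s`,
`cuspSlope a T δ ≤ s · cuspSlope a T x` — the defect is the exact constant of an affine bound `σ ≤ v(δ₀)·spread` on the
chamber (for `s = 0` the displacement is radial and `σ(δ) = 0`). -/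
theorem cuspSlope_le_spread_mul_value {a : Dir} (hpos : ∀ k, 0 < h28 a k) {T : ℝ} (hT : 0 < T)
    (hper : ∀ k : Fin 28, ∃ z : ℤ, T * h28 a k = z)
    {δ₀ : Fin 8 → ℝ} (hgen : ∀ k l : Fin 28, k ≠ l → phiForm δ₀ k / h28 a k ≠ phiForm δ₀ l / h28 a l)
    {x : Fin 8 → ℝ}
    (hxmax : ∀ δ : Fin 8 → ℝ, (∀ k l : Fin 28, phiForm δ k / h28 a k < phiForm δ l / h28 a l →
        phiForm δ₀ k / h28 a k < phiForm δ₀ l / h28 a l) →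
      (∀ k l : Fin 28, phiForm δ₀ k / h28 a k < phiForm δ₀ l / h28 a l →
        phiForm δ l / h28 a l - phiForm δ k / h28 a k ≤ 1) → cuspSlope a T δ ≤ cuspSlope a T x)
    {s : ℝ} (hs : 0 ≤ s) {δ : Fin 8 → ℝ}
    (href : ∀ k l : Fin 28, phiForm δ k / h28 a k < phiForm δ l / h28 a l →
      phiForm δ₀ k / h28 a k < phiForm δ₀ l / h28 a l)
    (hgap : ∀ k l : Fin 28, phiForm δ₀ k / h28 a k < phiForm δ₀ l / h28 a l →
      phiForm δ l / h28 a l - phiForm δ k / h28 a k ≤ s) :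
    cuspSlope a T δ ≤ s * cuspSlope a T x := by
  rcases hs.eq_or_lt with rfl | hs'
  · -- all selected gaps vanish: every rate equals the first one, `δ` is radial, `σ(δ) = 0`
    have hle : ∀ k l : Fin 28, phiForm δ₀ k / h28 a k < phiForm δ₀ l / h28 a l →
        phiForm δ k / h28 a k = phiForm δ l / h28 a l := fun k l hkl =>
      le_antisymm (rate_le_rate_of_refines href hkl) (by linarith [hgap k l hkl])
    have hall : ∀ k, phiForm δ k / h28 a k = phiForm δ 0 / h28 a 0 := fun k => by
      by_cases hk : k = 0; · rw [hk]
      rcases lt_or_gt_of_ne (hgen k 0 hk) with h | h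
      · exact hle k 0 h
      · exact (hle 0 k h).symm
    rw [eq_smul_sParam_of_forall_rate_eq hpos hall, cuspSlope_smul_sParam hpos hT hper, zero_mul]
  · have h1 : cuspSlope a T (s⁻¹ • δ) ≤ cuspSlope a T x := by
      refine hxmax _ (refines_smul (inv_pos.mpr hs').le href) fun k l hkl => ?_
      rw [phiForm_smul, phiForm_smul, mul_div_assoc, mul_div_assoc, ← mul_sub]
      have h := hgap k l hkl
      calc s⁻¹ * (phiForm δ l / h28 a l - phiForm δ k / h28 a k) ≤ s⁻¹ * s :=
            mul_le_mul_of_nonneg_left h (inv_pos.mpr hs').le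
        _ = 1 := inv_mul_cancel₀ hs'.ne'
    rw [cuspSlope_smul hpos hT hper δ (inv_pos.mpr hs')] at h1
    have := mul_le_mul_of_nonneg_left h1 hs
    rwa [← mul_assoc, mul_inv_cancel₀ hs'.ne', one_mul] at this

/-- **THE CHAMBER ASCENT VALUE = THE LEAST DEFECT — CANONICAL FORM, NO STRUCTURAL HYPOTHESIS** (`F = Σ_m patternN a b_m`,
P2 g33; hpos / hT / hper / hF / hgen only): maximum of `σ` over the closed chamber cut to selected wall gaps `≤ 1` =
minimum total positive part of a wall-gap representation of the chamber functional. No value at a named direction. -/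
theorem chamber_value_duality_canonical {a : Dir} (hpos : ∀ k, 0 < h28 a k) {T : ℝ} (hT : 0 < T)
    (hper : ∀ k : Fin 28, ∃ z : ℤ, T * h28 a k = z) {F : Finset (Fin 28) → ℝ}
    (hF : ∀ A, F A = ∑ m ∈ Finset.range ((bkpts a T).card - 1), ((patternN a (bkpt a T m) A : ℤ) : ℝ))
    {δ₀ : Fin 8 → ℝ} (hgen : ∀ k l : Fin 28, k ≠ l → phiForm δ₀ k / h28 a k ≠ phiForm δ₀ l / h28 a l) :
    ∃ (x : Fin 8 → ℝ) (μ ν : Fin 28 → Fin 28 → ℝ),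
      (∀ k l : Fin 28, phiForm x k / h28 a k < phiForm x l / h28 a l →
        phiForm δ₀ k / h28 a k < phiForm δ₀ l / h28 a l) ∧
      (∀ k l : Fin 28, phiForm δ₀ k / h28 a k < phiForm δ₀ l / h28 a l →
        phiForm x l / h28 a l - phiForm x k / h28 a k ≤ 1) ∧
      (∀ k l, 0 ≤ μ k l) ∧ (∀ k l, 0 ≤ ν k l) ∧
      (∀ δ : Fin 8 → ℝ,
        ∑ k, (F (Finset.univ.filter fun l => phiForm δ₀ k / h28 a k ≤ phiForm δ₀ l / h28 a l) -
            F (Finset.univ.filter fun l => phiForm δ₀ k / h28 a k < phiForm δ₀ l / h28 a l)) *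
          (phiForm δ k / h28 a k) =
        ∑ k, ∑ l, (if phiForm δ₀ k / h28 a k < phiForm δ₀ l / h28 a l then
          (ν k l - μ k l) * (phiForm δ l / h28 a l - phiForm δ k / h28 a k) else 0)) ∧
      cuspSlope a T x = ∑ k, ∑ l, (if phiForm δ₀ k / h28 a k < phiForm δ₀ l / h28 a l then ν k l else 0) ∧
      (∀ δ : Fin 8 → ℝ, (∀ k l : Fin 28, phiForm δ k / h28 a k < phiForm δ l / h28 a l →
          phiForm δ₀ k / h28 a k < phiForm δ₀ l / h28 a l) →
        (∀ k l : Fin 28, phiForm δ₀ k / h28 a k < phiForm δ₀ l / h28 a l →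
          phiForm δ l / h28 a l - phiForm δ k / h28 a k ≤ 1) → cuspSlope a T δ ≤ cuspSlope a T x) ∧
      (∀ μ' ν' : Fin 28 → Fin 28 → ℝ, (∀ k l, 0 ≤ μ' k l) → (∀ k l, 0 ≤ ν' k l) →
        (∀ δ : Fin 8 → ℝ,
          ∑ k, (F (Finset.univ.filter fun l => phiForm δ₀ k / h28 a k ≤ phiForm δ₀ l / h28 a l) -
              F (Finset.univ.filter fun l => phiForm δ₀ k / h28 a k < phiForm δ₀ l / h28 a l)) *
            (phiForm δ k / h28 a k) =
          ∑ k, ∑ l, (if phiForm δ₀ k / h28 a k < phiForm δ₀ l / h28 a l then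
            (ν' k l - μ' k l) * (phiForm δ l / h28 a l - phiForm δ k / h28 a k) else 0)) →
        cuspSlope a T x ≤ ∑ k, ∑ l, (if phiForm δ₀ k / h28 a k < phiForm δ₀ l / h28 a l then ν' k l else 0)) := by
  classical
  exact chamber_value_duality hpos hT hper
    (M := fun m => Finset.univ.filter fun k => ∃ z : ℤ, bkpt a T m * h28 a k = z)
    (f := fun m A => ((patternN a (bkpt a T m) A : ℤ) : ℝ)) (canonical_junction_agreement a T)
    (canonical_period_eq_sum_inter hF) hgen

end Summit.KontsevichZagierPeriods.Zeta5Search.Barrier.ConeGamma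

end
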